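/-
Copyright (c) 2026 the pub-hodgecm-mathlib formalisation cell (harness21).  Prover seat hodgecm-mathlib-LH4-p05 (g4), req620 Track A «(D-RAM) FOUR-FRAME» squad
((R-24)(b) «CLOSED ★ TWIN OF THE U3 EXPORT», dealer LH4-plan (g12) WORD #23, heir LEAD F0P3a-plan (g20) T19-00): the kernel-closed cone of U3 ED. 15's export
`u3_fourFrameLawsWildOfRecordR2 : FourFrameLawsWildOfRecordR2 omegaR` re-composed OUTSIDE the Lines tree over ★ `Theorems/F0P3cDyRam*` payers only.  2026-09-04.
-/
import Summits.HodgeConjecture.HodgeConjecture.Theorems.F0P3cDyRamFourFrameLawDefs   -- ★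
import Summits.HodgeConjecture.HodgeConjecture.Theorems.F0P3cDyRamFourFrameLawDefsR   -- ★
import Summits.HodgeConjecture.HodgeConjecture.Theorems.F0P3cDyRamStableLawOfModelSum   -- ★ p855240
import Summits.HodgeConjecture.HodgeConjecture.Theorems.F0P3cDyRamNormIndexTwo   -- ★ p855402
import Summits.HodgeConjecture.HodgeConjecture.Theorems.F0P3cDyRamKappaAbsLawOfKappaModelSum   -- ★ p855529
import Summits.HodgeConjecture.HodgeConjecture.Theorems.F0P3cDyRamKappaSignLawR2OfKappaSignModelSum   -- ★ p856997
import Summits.HodgeConjecture.HodgeConjecture.Theorems.F0P3cDyRamStableModelSumOfStageB   -- ★ p856175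
import Summits.HodgeConjecture.HodgeConjecture.Theorems.F0P3cDyRamDiagonalOrbitCount   -- ★ p856135
import Summits.HodgeConjecture.HodgeConjecture.Theorems.F0P3cDyRamStableCountTypeZero   -- ★
import Summits.HodgeConjecture.HodgeConjecture.Theorems.F0P3cDyRamStableCountTypeTwo   -- ★
import Summits.HodgeConjecture.HodgeConjecture.Theorems.F0P3cDyRamKappaModelSumOfKappaStageB   -- ★ p856604
import Summits.HodgeConjecture.HodgeConjecture.Theorems.F0P3cDyRamKappaSignModelSum2OfKappaStageB   -- ★ p856996
import Summits.HodgeConjecture.HodgeConjecture.Theorems.F0P3cDyRamOmegaRDefs   -- ★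
import Summits.HodgeConjecture.HodgeConjecture.Theorems.F0P3cDyRamDiagonalKappaOrbitCountMult   -- ★ p856633
import Summits.HodgeConjecture.HodgeConjecture.Theorems.F0P3cDyRamKappaCountTypeZeroPaid   -- ★ p856938
import Summits.HodgeConjecture.HodgeConjecture.Theorems.F0P3cDyRamKappaCountTypeTwoPaid   -- ★ p856993
import Summits.HodgeConjecture.HodgeConjecture.Theorems.F0P3cDyRamKappaSignCount2TypeZero   -- ★ p857128
import Summits.HodgeConjecture.HodgeConjecture.Theorems.F0P3cDyRamKappaSignCount2TypeTwoMult   -- ★ p857148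
import HarnessLib

/-!
# Crux `H413`, line LH4 «(D-RAM) FOUR-FRAME» road — THE FOUR-FRAME CENSUS LAWS OF RECORD, Ω-AWARE, AS A ★ THEOREM:
# `fourFrameLawsWildOfRecordR2_omegaR : FourFrameLawsWildOfRecordR2 omegaR` (the closed ★ twin of unit U3's export, rule 57: no `Cruxes.H413.Lines.*` import)

Cell `hodgecm-mathlib` (D-0151), FLOOR 0, crux item H413 = `stmt-HodgeConjecture-24833`, route of record `HCCMUnconditional`; squad F0∕P3c∕LH4 (req618∕req620).  THEOREMS ONLY (no
`def`, no instance, no notation, no `sorry`, default heartbeats); lane `--supports stmt-HodgeConjecture-24833 --as helper` (count-neutral: it is the `hU3` ARGUMENT of the tier-0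
ED. 4 pay line `stub_rows_unit0 := pieceRowsWild_gselStar_zero_of hU3 hDH hDG` (LH4-p11 (g4)'s (R-24) hypothesis-form twin), cut only on the heir LEAD's word).

WHAT.  Unit U3 (`Cruxes/H413/Lines/F0_P3c_DyRamFourFrame_U3_Laws.lean`, ED. 15 «(κS-B₂²) PAID» e5c2ce7e, 45 decls, SORRY-FREE, every decl TRIO — REF1 (g21) m11, LH4-p05 (g4) box P05-3)
concludes BY NAME ★ DEFS LEAF №1-R2's closed Prop `FourFrameLawsWildOfRecordR2 omegaR` (★ p856987 LH4-p10 (g3); `omegaR` ★ p857033): behind the dyadic fence, at every wild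
ramified quadratic datum over a complete field with finite residue field, the STABLE law (S)At, the re-cut κ-AMPLITUDE law (K-ABS-R)At and the Ω-aware re-cut κ-SIGN law (K-SGN-R2)At
at the parameters of record `(depthOfRecord, tauOfRecord)`.  A Theorems file may not import a Lines module (rule 57), so this file RE-COMPOSES the reverse cone of that export —
the 19 U3 decls it reaches, machine-extracted from the frozen ED. 15, statements VERBATIM, helper names `stub_U3_*`∕`u3_*` ↦ `u3x_*`, bodies the SAME kernel terms over the ★
payers the U3 pay lines already name: (NI2) ★ p855402 `normIndexTwo`; (MS-A₂) ★ `…DiagonalOrbitCount` ED. 2; (MS-B₂) ★ `…StableCountTypeTwo`; (MS) ★ p856175 ED. 2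
`stableModelSum_of_stageB_mult` over ★ B10 `…StableCountTypeZero`; (S) ★ p855240 `stableLawAt_of_normIndexTwo_of_modelSum`; (κ-A₂) ★ p856633; (κ-B₀) ★ p856938; (κ-B₂)
★ p856993; (KMS) ★ p856682 `kappaModelSum_of_kappaStageB_complete`; (K-ABS-R) ★ p855529; (κS-B₀²) ★ p857128 (LH4-p04 (g3)); (κS-B₂²) ★ p857148 (LH4-p07 (g6)); (KSS²) ★ p856996
`kappaSignModelSum2_of_kappaStageB_complete omegaR` (this seat); (K-SGN-R2) ★ p856997 (LH4-p10 (g3)); assembly ★ №1-R2 `fourFrameLawsWildAtR2_of_fenced`.  The HEAD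
`fourFrameLawsWildOfRecordR2_omegaR` has the TYPE of U3's `u3_fourFrameLawsWildOfRecordR2` (HOME probe `F0/P3c/LH4/LH4-p05/g4/R2Twin.TIE.v1.LH4p05g4.lean`:
`example : type_of% @fourFrameLawsWildOfRecordR2_omegaR = type_of% @…F0P3cDyRamFourFrameU3.u3_fourFrameLawsWildOfRecordR2 := rfl`).
HONEST LABEL.  Count-neutral (`--supports`); a composition of ★ theorems, nothing printed is asserted; the census laws were PROVER TARGETS and are now ★ kernel theorems of the
diagonal model; on the covered set `d % 2 = 1 ∨ 2 * d ≤ t + 2` the sign conjunct is ★ №1-R's `KappaSignLawAtR` through ★ p857007∕p857042 (heir LEAD T18-59 (H2)); `HC_CM` is proved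
only modulo the 7 printed citations (2 remaining named inputs: hLiu418 = `stmt-HodgeConjecture-24832`, h413 = `stmt-HodgeConjecture-24833`) until rung 0 closes.

## References
* [Rogawski1990] J. D. Rogawski, *Automorphic Representations of Unitary Groups in Three Variables*, Ann. of Math. Stud. 123 (1990), §4.9 Prop. 4.9.1 (a) p. 55, §4.10 p. 58, §12.2.
* [Kottwitz1986BaseChangeUnits] R. E. Kottwitz, *Base change for unit elements of Hecke algebras*, Compositio Math. 60 (1986), §1 pp. 240–241, §3.
* [LanglandsShelstad1987] R. P. Langlands, D. Shelstad, *On the definition of transfer factors*, Math. Ann. 278 (1987), §1.3, §3.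
-/

set_option autoImplicit false

noncomputable section

namespace Summit.HodgeConjecture.HodgeConjecture.Cruxes.H413.F0P3cDyRamFourFrameLawsWildOfRecordR2

open scoped Valued WithZero Matrix MatrixGroups
open Finset
open Literature.NumberTheory.Automorphic Literature.NumberTheory.Automorphic.HermitianLattice
  Literature.NumberTheory.Automorphic.UnitaryLatticeTree Literature.NumberTheory.Automorphic.UnitaryThreeFourFrame
open Summit.HodgeConjecture.HodgeConjecture.Cruxes.H413.F0P3cDyRamFourFrameLawDefs
open Summit.HodgeConjecture.HodgeConjecture.Cruxes.H413.F0P3cDyRamFourFrameLawDefsR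
open Summit.HodgeConjecture.HodgeConjecture.Cruxes.H413.F0P3cDyRamDiagonalTorusDefs (normalisedStableLattices stabiliserWeight IsDualisableLattice)
open Summit.HodgeConjecture.HodgeConjecture.Cruxes.H413.F0P3cDyRamDiagonalStrataDefs (polarisationCount IsTypeTwoPolarisable)
open Summit.HodgeConjecture.HodgeConjecture.Cruxes.H413.F0P3cDyRamDiagonalKappaCountDefs (kappaCount)
open Summit.HodgeConjecture.HodgeConjecture.Cruxes.H413.F0P3cDyRamFourFrameLawDefsR2 (OmegaSchedule KappaSignLawAtS2 KappaSignLawAtR2 FourFrameLawsWildOfRecordR2 fourFrameLawsWildAtR2_of_fenced)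
open Summit.HodgeConjecture.HodgeConjecture.Cruxes.H413.F0P3cDyRamOmegaRDefs (omegaR)
/-- **(MS-A₂) Stage A at type 2 with multiplicity** — ★ twin of U3 ED. 15 `stub_U3_stageA_typeTwo_mult` (tree `Cruxes/H413/Lines/F0_P3c_DyRamFourFrame_U3_Laws.lean` e5c2ce7e :161): statement VERBATIM, body = the same kernel term over ★ payers (no `stub_` name).
[cite: Rogawski1990, §4.9 Prop. 4.9.1 (a) p. 55] [cite: Kottwitz1986BaseChangeUnits, §1 pp. 240–241] [cite: LanglandsShelstad1987, §3] -/
theorem u3x_stageA_typeTwo_mult :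
    ∀ {K : Type} [Field K] [Valued K ℤᵐ⁰] [Finite 𝓀[K]] {σ : K →+* K}, (∀ x, σ (σ x) = x) → (∀ a, Valued.v (σ a) = Valued.v a) →
      ∀ {ϖ : K}, Valued.v ϖ = WithZero.exp (-1 : ℤ) → ∀ (ϖu : Kˣ), (ϖu : K) = ϖ →
      ∀ {c : K}, σ c = c → Valued.v c = 1 → (¬ ∃ z : K, z * σ z = c) →
      (∀ x : K, σ x = x → x ≠ 0 → (∃ z : K, z * σ z = x) ∨ ∃ z : K, z * σ z = c * x) →
      ∀ {s : Fin 3 → K}, (∀ i, Valued.v (s i) = 1) → (∀ i j, i ≠ j → s i ≠ s j) →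
      ∀ (T : GL (Fin 3) K), (T : Matrix (Fin 3) (Fin 3) K) = Matrix.diagonal s →
        (((∑ e : Fin 3 → Bool, {M : Submodule 𝒪[K] (Fin 3 → K) |
            IsVertexLattice σ ϖ (Matrix.diagonal fun i => if e i then c else (1 : K)) 2 M ∧ mapGL T M = M}.ncard : ℕ) : ℚ)) =
          8 * ∑ᶠ M₀ ∈ normalisedStableLattices T, (polarisationCount σ ϖ 2 M₀ : ℚ) * stabiliserWeight σ M₀ :=
  fun hσ hvσ => fun hϖ ϖu hϖu => fun hσc hcv hc hdich => fun hs hreg T hT =>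
    Summit.HodgeConjecture.HodgeConjecture.Cruxes.H413.F0P3cDyRamDiagonalOrbitCount.sum_ncard_fixed_vertices_eq_eight_mul_finsum_polarisationCount_mul_stabiliserWeight
      hσ hvσ hϖ ϖu hϖu hσc hcv hc hdich hs hreg T hT 2  -- PAID ED. 8 (★ OrbitCount ED. 2; (MS-A₂) closed at birth)

/-- **(MS-B₂) the type-2 stable count with multiplicity** — ★ twin of U3 ED. 15 `stub_U3_stableCount_typeTwo_mult` (tree `Cruxes/H413/Lines/F0_P3c_DyRamFourFrame_U3_Laws.lean` e5c2ce7e :183): statement VERBATIM, body = the same kernel term over ★ payers (no `stub_` name).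
[cite: Rogawski1990, §4.9 Prop. 4.9.1 (a) p. 55] [cite: Kottwitz1986BaseChangeUnits, §1 pp. 240–241] [cite: LanglandsShelstad1987, §3] -/
theorem u3x_stableCount_typeTwo_mult :
    ∀ {K : Type} [Field K] [Valued K ℤᵐ⁰] [Fintype 𝓀[K]] {σ : K →+* K} {ϖ : K} {d t : ℕ}, IsRamifiedQuadraticDatum σ ϖ d t →
      Valued.v (2 : K) < 1 → ∀ {α β : K} {N₀ n₁ n₂ n₃ : ℕ}, IsElementDatum σ ϖ N₀ α β n₁ n₂ n₃ → d ≤ N₀ →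
      ∀ (T : GL (Fin 3) K), (T : Matrix (Fin 3) (Fin 3) K) = Matrix.diagonal ![α, β, 1] → ∀ (k : ℕ), 2 * k + d = n₁ + n₂ + n₃ + 2 →
        ∑ᶠ M ∈ normalisedStableLattices T, (polarisationCount σ ϖ 2 M : ℚ) * stabiliserWeight σ M =
          ((Fintype.card 𝓀[K] : ℚ) ^ k - 1) / ((Fintype.card 𝓀[K] : ℚ) - 1) :=
  fun hD h2 => fun hE hN₀ T hT k hk =>
    Summit.HodgeConjecture.HodgeConjecture.Cruxes.H413.F0P3cDyRamStableCountTypeTwo.finsum_polarisationCount_mul_stabiliserWeight_eq hD h2 hE hN₀ T hT k hk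
  -- PAID ED. 9′ (★ `F0P3cDyRamStableCountTypeTwo`; (MS-B₂) closed ⇒ (MS) and EMIT #7∕#8 TRIO)

/-- **(MS) the eightfold stable model sum** — ★ twin of U3 ED. 15 `stub_U3_stableModelSum` (tree `Cruxes/H413/Lines/F0_P3c_DyRamFourFrame_U3_Laws.lean` e5c2ce7e :205): statement VERBATIM, body = the same kernel term over ★ payers (no `stub_` name).
[cite: Rogawski1990, §4.9 Prop. 4.9.1 (a) p. 55] [cite: Kottwitz1986BaseChangeUnits, §1 pp. 240–241] [cite: LanglandsShelstad1987, §3] -/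
theorem u3x_stableModelSum :
    ∀ {K : Type} [Field K] [Valued K ℤᵐ⁰] [CompleteSpace K] [Fintype 𝓀[K]] (σ : K →+* K) (ϖ : K) (d t : ℕ),
      DyadicFence (K := K) (IsRamifiedQuadraticDatum σ ϖ d t →
        ∀ c : K, σ c = c → Valued.v c = 1 → (∀ x : K, σ x = x → x ≠ 0 → (∃ z : K, z * σ z = x) ∨ ∃ z : K, z * σ z = c * x) →
        ∀ (α β : K) (n₁ n₂ n₃ : ℕ), IsElementDatum σ ϖ (depthOfRecord d) α β n₁ n₂ n₃ →
        ∀ (T : GL (Fin 3) K), (T : Matrix (Fin 3) (Fin 3) K) = Matrix.diagonal ![α, β, 1] →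
        ∀ (k : ℕ), 2 * k + d = n₁ + n₂ + n₃ + 2 → ∀ tv : ℕ, tv = 0 ∨ tv = 2 →
          ((∑ s : Fin 3 → Bool, {M : Submodule 𝒪[K] (Fin 3 → K) |
              IsVertexLattice σ ϖ (Matrix.diagonal fun i => if s i then c else (1 : K)) tv M ∧ mapGL T M = M}.ncard : ℕ) : ℚ) =
            8 * ((Fintype.card 𝓀[K] : ℚ) ^ k - 1) / ((Fintype.card 𝓀[K] : ℚ) - 1)) :=
  -- PAID ED. 8 BY COMPOSITION («MS := B10 (type 0) ⊕ (MS-A₂) ⊕ (MS-B₂)», ★ `stableModelSum_of_stageB_mult`; axioms = trio ∪ the `sorryAx` of exactly (MS-B₂))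
  Summit.HodgeConjecture.HodgeConjecture.Cruxes.H413.F0P3cDyRamStableModelSumOfStageB.stableModelSum_of_stageB_mult
    (fun hD h2 => fun hE hN₀ T hT k hk =>
      Summit.HodgeConjecture.HodgeConjecture.Cruxes.H413.F0P3cDyRamStableCountTypeZero.finsum_stabiliserWeight_dualisable_eq hD h2 hE hN₀ T hT k hk)
    u3x_stageA_typeTwo_mult u3x_stableCount_typeTwo_mult

/-- **the fenced stable cut from (NI2) ⊕ (MS)** — ★ twin of U3 ED. 15 `u3_stableLaw_ofRecord_of_NI2_MS` (tree `Cruxes/H413/Lines/F0_P3c_DyRamFourFrame_U3_Laws.lean` e5c2ce7e :223): statement VERBATIM, body = the same kernel term over ★ payers (no `stub_` name).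
[cite: Rogawski1990, §4.9 Prop. 4.9.1 (a) p. 55] [cite: Kottwitz1986BaseChangeUnits, §1 pp. 240–241] [cite: LanglandsShelstad1987, §3] -/
theorem u3x_stableLaw_ofRecord_of_NI2_MS {K : Type} [Field K] [Valued K ℤᵐ⁰] [CompleteSpace K] [Fintype 𝓀[K]] (σ : K →+* K) (ϖ : K) (d t : ℕ) :
    DyadicFence (K := K) (StableLawAt depthOfRecord σ ϖ d t) := fun h2 hD =>
  F0P3cDyRamStableLawOfModelSum.stableLawAt_of_normIndexTwo_of_modelSum depthOfRecord σ ϖ d t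
    (Summit.HodgeConjecture.HodgeConjecture.Cruxes.H413.F0P3cDyRamNormIndexTwo.normIndexTwo σ ϖ d t hD) (u3x_stableModelSum σ ϖ d t h2 hD) hD

/-- **(S) R-P — the stable law at ramified-prime data (d odd)** — ★ twin of U3 ED. 15 `stub_U3_stableLaw_RP` (tree `Cruxes/H413/Lines/F0_P3c_DyRamFourFrame_U3_Laws.lean` e5c2ce7e :235): statement VERBATIM, body = the same kernel term over ★ payers (no `stub_` name).
[cite: Rogawski1990, §4.9 Prop. 4.9.1 (a) p. 55] [cite: Kottwitz1986BaseChangeUnits, §1 pp. 240–241] [cite: LanglandsShelstad1987, §3] -/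
theorem u3x_stableLaw_RP :
    ∀ {K : Type} [Field K] [Valued K ℤᵐ⁰] [CompleteSpace K] [Fintype 𝓀[K]] (σ : K →+* K) (ϖ : K) (d t : ℕ),
      d % 2 = 1 → DyadicFence (K := K) (StableLawAt depthOfRecord σ ϖ d t) :=
  fun σ ϖ d t _ => u3x_stableLaw_ofRecord_of_NI2_MS σ ϖ d t

/-- **(S) R-U — the stable law at ramified-unit data (d even)** — ★ twin of U3 ED. 15 `stub_U3_stableLaw_RU` (tree `Cruxes/H413/Lines/F0_P3c_DyRamFourFrame_U3_Laws.lean` e5c2ce7e :244): statement VERBATIM, body = the same kernel term over ★ payers (no `stub_` name).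
[cite: Rogawski1990, §4.9 Prop. 4.9.1 (a) p. 55] [cite: Kottwitz1986BaseChangeUnits, §1 pp. 240–241] [cite: LanglandsShelstad1987, §3] -/
theorem u3x_stableLaw_RU :
    ∀ {K : Type} [Field K] [Valued K ℤᵐ⁰] [CompleteSpace K] [Fintype 𝓀[K]] (σ : K →+* K) (ϖ : K) (d t : ℕ),
      d % 2 = 0 → DyadicFence (K := K) (StableLawAt depthOfRecord σ ϖ d t) :=
  fun σ ϖ d t _ => u3x_stableLaw_ofRecord_of_NI2_MS σ ϖ d t

/-- **the fenced stable cut at every datum (by parity)** — ★ twin of U3 ED. 15 `u3_stableLaw_ofRecord` (tree `Cruxes/H413/Lines/F0_P3c_DyRamFourFrame_U3_Laws.lean` e5c2ce7e :323): statement VERBATIM, body = the same kernel term over ★ payers (no `stub_` name).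
[cite: Rogawski1990, §4.9 Prop. 4.9.1 (a) p. 55] [cite: Kottwitz1986BaseChangeUnits, §1 pp. 240–241] [cite: LanglandsShelstad1987, §3] -/
theorem u3x_stableLaw_ofRecord {K : Type} [Field K] [Valued K ℤᵐ⁰] [CompleteSpace K] [Fintype 𝓀[K]] (σ : K →+* K) (ϖ : K) (d t : ℕ) :
    DyadicFence (K := K) (StableLawAt depthOfRecord σ ϖ d t) := by
  rcases Nat.mod_two_eq_zero_or_one d with h | h
  · exact u3x_stableLaw_RU σ ϖ d t h
  · exact u3x_stableLaw_RP σ ϖ d t h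

/-- **(KMS) the eightfold κ-model sum** — ★ twin of U3 ED. 15 `stub_U3_kappaModelSum` (tree `Cruxes/H413/Lines/F0_P3c_DyRamFourFrame_U3_Laws.lean` e5c2ce7e :554): statement VERBATIM, body = the same kernel term over ★ payers (no `stub_` name).
[cite: Rogawski1990, §4.9 Prop. 4.9.1 (a) p. 55] [cite: Kottwitz1986BaseChangeUnits, §1 pp. 240–241] [cite: LanglandsShelstad1987, §3] -/
theorem u3x_kappaModelSum :
    ∀ {K : Type} [Field K] [Valued K ℤᵐ⁰] [CompleteSpace K] [Fintype 𝓀[K]] (σ : K →+* K) (ϖ : K) (d t : ℕ),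
      DyadicFence (K := K) (IsRamifiedQuadraticDatum σ ϖ d t →
        ∀ c : K, σ c = c → Valued.v c = 1 → (∀ x : K, σ x = x → x ≠ 0 → (∃ z : K, z * σ z = x) ∨ ∃ z : K, z * σ z = c * x) →
        ∀ (α β : K) (n₁ n₂ n₃ : ℕ), IsElementDatum σ ϖ (depthOfRecord d) α β n₁ n₂ n₃ →
        ∀ (T : GL (Fin 3) K), (T : Matrix (Fin 3) (Fin 3) K) = Matrix.diagonal ![α, β, 1] →
        ∀ (k : ℕ), 2 * k + d = n₁ + n₂ + n₃ + 2 →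
        ∀ (i : Fin 3) (B : ℤ), 2 * B = ((![n₁, n₂, n₃] : Fin 3 → ℕ) i : ℤ) - d + 2 - 2 * shiftR d t →
          |((∑ s : Fin 3 → Bool,
              (![(if s 1 then -1 else 1) * (if s 2 then -1 else 1),
                 (if s 0 then -1 else 1) * (if s 2 then -1 else 1),
                 (if s 0 then -1 else 1) * (if s 1 then -1 else 1)] : Fin 3 → ℤ) i *
                ({M : Submodule 𝒪[K] (Fin 3 → K) |
                  IsVertexLattice σ ϖ (Matrix.diagonal fun j => if s j then c else (1 : K)) 0 M ∧ mapGL T M = M}.ncard : ℤ) : ℤ) : ℚ)| =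
            2 * ampl (Fintype.card 𝓀[K]) k B ∧
          |((∑ s : Fin 3 → Bool,
              (![(if s 1 then -1 else 1) * (if s 2 then -1 else 1),
                 (if s 0 then -1 else 1) * (if s 2 then -1 else 1),
                 (if s 0 then -1 else 1) * (if s 1 then -1 else 1)] : Fin 3 → ℤ) i *
                ({M : Submodule 𝒪[K] (Fin 3 → K) |
                  IsVertexLattice σ ϖ (Matrix.diagonal fun j => if s j then c else (1 : K)) 2 M ∧ mapGL T M = M}.ncard : ℤ) : ℤ) : ℚ)| =
            2 * ampl (Fintype.card 𝓀[K]) k (B + tauOfRecord d)) :=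
  -- PAID ED. 10 BY COMPOSITION («KMS := (κ-A₂) ⊕ (κ-B₀) ⊕ (κ-B₂)», ★ ED. 2 head `kappaModelSum_of_kappaStageB_complete` (ED. 1 p856604 ∕ ED. 2 p856682); axioms = trio ∪ the `sorryAx` of exactly (κ-B₀)(κ-B₂))
  F0P3cDyRamKappaModelSumOfKappaStageB.kappaModelSum_of_kappaStageB_complete
    F0P3cDyRamDiagonalKappaOrbitCountMult.kappaStageA_typeTwo_mult Summit.HodgeConjecture.HodgeConjecture.Cruxes.H413.F0P3cDyRamKappaCountTypeZeroPaid.kappaCount_typeZero Summit.HodgeConjecture.HodgeConjecture.Cruxes.H413.F0P3cDyRamKappaCountTypeTwoPaid.kappaCount_typeTwo_mult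

/-- **(K-ABS-R) the fenced re-cut κ-amplitude law** — ★ twin of U3 ED. 15 `stub_U3_kappaAbsLawR` (tree `Cruxes/H413/Lines/F0_P3c_DyRamFourFrame_U3_Laws.lean` e5c2ce7e :583): statement VERBATIM, body = the same kernel term over ★ payers (no `stub_` name).
[cite: Rogawski1990, §4.9 Prop. 4.9.1 (a) p. 55] [cite: Kottwitz1986BaseChangeUnits, §1 pp. 240–241] [cite: LanglandsShelstad1987, §3] -/
theorem u3x_kappaAbsLawR :
    ∀ {K : Type} [Field K] [Valued K ℤᵐ⁰] [CompleteSpace K] [Fintype 𝓀[K]] (σ : K →+* K) (ϖ : K) (d t : ℕ),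
      DyadicFence (K := K) (KappaAmplitudeLawAtR depthOfRecord tauOfRecord σ ϖ d t) := fun σ ϖ d t h2 hD =>
  Summit.HodgeConjecture.HodgeConjecture.Cruxes.H413.F0P3cDyRamKappaAbsLawOfKappaModelSum.dyadicFence_kappaAmplitudeLawAtR_of_kappaModelSum8 σ ϖ d t
    (u3x_kappaModelSum σ ϖ d t h2 hD) h2 hD

/-- **(KSS²) the Ω-aware signed eightfold κ-model sum at `omegaR`** — ★ twin of U3 ED. 15 `stub_U3_kappaSignModelSum2` (tree `Cruxes/H413/Lines/F0_P3c_DyRamFourFrame_U3_Laws.lean` e5c2ce7e :641): statement VERBATIM, body = the same kernel term over ★ payers (no `stub_` name).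
[cite: Rogawski1990, §4.9 Prop. 4.9.1 (a) p. 55] [cite: Kottwitz1986BaseChangeUnits, §1 pp. 240–241] [cite: LanglandsShelstad1987, §3] -/
theorem u3x_kappaSignModelSum2 :
    ∀ {K : Type} [Field K] [Valued K ℤᵐ⁰] [CompleteSpace K] [Fintype 𝓀[K]] (σ : K →+* K) (ϖ : K) (d t : ℕ),
      DyadicFence (K := K) (IsRamifiedQuadraticDatum σ ϖ d t →
        ∀ c : K, σ c = c → Valued.v c = 1 → (∀ x : K, σ x = x → x ≠ 0 → (∃ z : K, z * σ z = x) ∨ ∃ z : K, z * σ z = c * x) →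
        ∀ (δ : K), σ δ = -δ → δ ≠ 0 →
        ∀ (a b : K), a * σ a = 1 → b * σ b = 1 → Valued.v (a - 1) < Valued.v (2 : K) → Valued.v (b - 1) < Valued.v (2 : K) →
        ∀ (n₁ n₂ n₃ : ℕ), IsElementDatum σ ϖ (depthOfRecord d) (a * a) (b * b) n₁ n₂ n₃ →
        ∀ (T : GL (Fin 3) K), (T : Matrix (Fin 3) (Fin 3) K) = Matrix.diagonal ![a * a, b * b, 1] →
        ∀ (k : ℕ), 2 * k + d = n₁ + n₂ + n₃ + 2 →
        ∀ (i : Fin 3) (B : ℤ), 2 * B = ((![n₁, n₂, n₃] : Fin 3 → ℕ) i : ℤ) - d + 2 - 2 * shiftR d t →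
          ((∑ s : Fin 3 → Bool,
              (![(if s 1 then -1 else 1) * (if s 2 then -1 else 1),
                 (if s 0 then -1 else 1) * (if s 2 then -1 else 1),
                 (if s 0 then -1 else 1) * (if s 1 then -1 else 1)] : Fin 3 → ℤ) i *
                ({M : Submodule 𝒪[K] (Fin 3 → K) |
                  IsVertexLattice σ ϖ (Matrix.diagonal fun j => if s j then c else (1 : K)) 0 M ∧ mapGL T M = M}.ncard : ℤ) : ℤ) : ℚ) =
            2 * ((omegaR K σ ϖ d a b i * ((![normSign σ (-1 : K), normSign σ (-1 : K), 1] : Fin 3 → ℤ) i *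
              (baseSign σ i * normSign σ (fPartProd δ ![a, b, 1] i))) : ℤ) : ℚ) * ampl (Fintype.card 𝓀[K]) k B ∧
          ((∑ s : Fin 3 → Bool,
              (![(if s 1 then -1 else 1) * (if s 2 then -1 else 1),
                 (if s 0 then -1 else 1) * (if s 2 then -1 else 1),
                 (if s 0 then -1 else 1) * (if s 1 then -1 else 1)] : Fin 3 → ℤ) i *
                ({M : Submodule 𝒪[K] (Fin 3 → K) |
                  IsVertexLattice σ ϖ (Matrix.diagonal fun j => if s j then c else (1 : K)) 2 M ∧ mapGL T M = M}.ncard : ℤ) : ℤ) : ℚ) =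
            2 * ((omegaR K σ ϖ d a b i * ((![normSign σ (-1 : K), normSign σ (-1 : K), 1] : Fin 3 → ℤ) i *
              (baseSign σ i * normSign σ (fPartProd δ ![a, b, 1] i))) : ℤ) : ℚ) * ampl (Fintype.card 𝓀[K]) k (B + tauOfRecord d)) :=
  -- PAID AT BIRTH BY COMPOSITION («KSS² := (κ-A₂) ⊕ (κS-B₀²) ⊕ (κS-B₂²)», ★ (iv) p856996 over the ★ engine p856977; axioms = trio ∪ the `sorryAx` of exactly (κS-B₀²)(κS-B₂²))
  F0P3cDyRamKappaSignModelSum2OfKappaStageB.kappaSignModelSum2_of_kappaStageB_complete omegaR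
    F0P3cDyRamDiagonalKappaOrbitCountMult.kappaStageA_typeTwo_mult Summit.HodgeConjecture.HodgeConjecture.Cruxes.H413.F0P3cDyRamKappaSignCount2TypeZero.kappaSignCount2_typeZero Summit.HodgeConjecture.HodgeConjecture.Cruxes.H413.F0P3cDyRamKappaSignCount2TypeTwoMult.kappaSignCount2_typeTwo_mult

/-- **(K-SGN-R2) the fenced Ω-aware re-cut κ-sign law at `omegaR`** — ★ twin of U3 ED. 15 `stub_U3_kappaSignLawR2` (tree `Cruxes/H413/Lines/F0_P3c_DyRamFourFrame_U3_Laws.lean` e5c2ce7e :678): statement VERBATIM, body = the same kernel term over ★ payers (no `stub_` name).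
[cite: Rogawski1990, §4.9 Prop. 4.9.1 (a) p. 55] [cite: Kottwitz1986BaseChangeUnits, §1 pp. 240–241] [cite: LanglandsShelstad1987, §3] -/
theorem u3x_kappaSignLawR2 :
    ∀ {K : Type} [Field K] [Valued K ℤᵐ⁰] [CompleteSpace K] [Fintype 𝓀[K]] (σ : K →+* K) (ϖ : K) (d t : ℕ),
      DyadicFence (K := K) (KappaSignLawAtR2 omegaR depthOfRecord tauOfRecord σ ϖ d t) := fun σ ϖ d t h2 hD =>
  Summit.HodgeConjecture.HodgeConjecture.Cruxes.H413.F0P3cDyRamKappaSignLawR2OfKappaSignModelSum.dyadicFence_kappaSignLawAtR2_of_kappaSignModelSum2_8 omegaR σ ϖ d t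
    (u3x_kappaSignModelSum2 σ ϖ d t h2 hD) h2 hD

/-- **★ №1-R2's closed Prop modulo the two κ-cuts as binders** — ★ twin of U3 ED. 15 `u3_fourFrameLawsWildOfRecordR2_of_kappa` (tree `Cruxes/H413/Lines/F0_P3c_DyRamFourFrame_U3_Laws.lean` e5c2ce7e :686): statement VERBATIM, body = the same kernel term over ★ payers (no `stub_` name).
[cite: Rogawski1990, §4.9 Prop. 4.9.1 (a) p. 55] [cite: Kottwitz1986BaseChangeUnits, §1 pp. 240–241] [cite: LanglandsShelstad1987, §3] -/
theorem u3x_fourFrameLawsWildOfRecordR2_of_kappa (Ω : OmegaSchedule)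
    (hKA : ∀ {K : Type} [Field K] [Valued K ℤᵐ⁰] [CompleteSpace K] [Fintype 𝓀[K]] (σ : K →+* K) (ϖ : K) (d t : ℕ),
      DyadicFence (K := K) (KappaAmplitudeLawAtR depthOfRecord tauOfRecord σ ϖ d t))
    (hKS : ∀ {K : Type} [Field K] [Valued K ℤᵐ⁰] [CompleteSpace K] [Fintype 𝓀[K]] (σ : K →+* K) (ϖ : K) (d t : ℕ),
      DyadicFence (K := K) (KappaSignLawAtR2 Ω depthOfRecord tauOfRecord σ ϖ d t)) :
    FourFrameLawsWildOfRecordR2 Ω :=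
  fun σ ϖ d t => fourFrameLawsWildAtR2_of_fenced Ω depthOfRecord tauOfRecord σ ϖ d t (u3x_stableLaw_ofRecord σ ϖ d t) (hKA σ ϖ d t) (hKS σ ϖ d t)

/-- **THE HEAD — ★ №1-R2's closed Prop `FourFrameLawsWildOfRecordR2 omegaR`, binder-free** — ★ twin of U3 ED. 15 `u3_fourFrameLawsWildOfRecordR2` (tree `Cruxes/H413/Lines/F0_P3c_DyRamFourFrame_U3_Laws.lean` e5c2ce7e :696): statement VERBATIM, body = the same kernel term over ★ payers (no `stub_` name).
[cite: Rogawski1990, §4.9 Prop. 4.9.1 (a) p. 55] [cite: Kottwitz1986BaseChangeUnits, §1 pp. 240–241] [cite: LanglandsShelstad1987, §3] -/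
theorem fourFrameLawsWildOfRecordR2_omegaR : FourFrameLawsWildOfRecordR2 omegaR :=
  u3x_fourFrameLawsWildOfRecordR2_of_kappa omegaR u3x_kappaAbsLawR u3x_kappaSignLawR2

end Summit.HodgeConjecture.HodgeConjecture.Cruxes.H413.F0P3cDyRamFourFrameLawsWildOfRecordR2

end
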